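import Summits.HubbardSuperconductivity.HubbardSuperconductivity.Theorems.AnisotropyChordTransferFibre3FinXDCheck

/-!
# Route `AnisotropyChord` / H0 rotor rung: FIN per-`L` row-D (KT-2a″) SUB-CELL facts, `L = 10` (54–59)

Row-D facts `xdCellAny0 10 (49/50) la lb aD = true` on quarter sub-cells of the combined cells whose side condition needs `aD ≈ .04` (mechhunt STATUS p3 g7 REPORT 3).
Prover seat `hubbard-h0-rotor-p3` g7; helper for piece A = stmt-HubbardSuperconductivity-23918 of rung 19089 (`--supports`, helper class).
WHAT THIS IS NOT: nothing here proves superconductivity in the Hubbard model (rotor TARGET as worded stays FALSE, g15 verdict); kernel facts /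
assembly for ONE conditional reduction at one `L`.  No sorry.
-/

set_option linter.dupNamespace false
set_option autoImplicit false

namespace Summit.HubbardSuperconductivity.HubbardSuperconductivity.Theorems.AnisotropyChord.Transfer.Fibre3

namespace FinXD

/-- row-D sub-cell `[19365649866820573, 19485190915381193]` of `L = 10`. [folklore] -/
theorem xd10s_142_2 : xdCellAny0 10 (49/50 : ℚ) 19365649866820573 19485190915381193 (1/25 : ℚ) = true := by decide +kernel

/-- row-D sub-cell `[19485190915381193, 19604731963941813]` of `L = 10`. [folklore] -/
theorem xd10s_142_3 : xdCellAny0 10 (49/50 : ℚ) 19485190915381193 19604731963941813 (1/25 : ℚ) = true := by decide +kernel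

/-- row-D sub-cell `[19604731963941813, 19727261538716449]` of `L = 10`. [folklore] -/
theorem xd10s_143_0 : xdCellAny0 10 (49/50 : ℚ) 19604731963941813 19727261538716449 (1/25 : ℚ) = true := by decide +kernel

/-- row-D sub-cell `[19727261538716449, 19849791113491085]` of `L = 10`. [folklore] -/
theorem xd10s_143_1 : xdCellAny0 10 (49/50 : ℚ) 19727261538716449 19849791113491085 (1/25 : ℚ) = true := by decide +kernel

/-- row-D sub-cell `[19849791113491085, 19972320688265721]` of `L = 10`. [folklore] -/
theorem xd10s_143_2 : xdCellAny0 10 (49/50 : ℚ) 19849791113491085 19972320688265721 (1/25 : ℚ) = true := by decide +kernel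

/-- row-D sub-cell `[19972320688265721, 20094850263040357]` of `L = 10`. [folklore] -/
theorem xd10s_143_3 : xdCellAny0 10 (49/50 : ℚ) 19972320688265721 20094850263040357 (1/25 : ℚ) = true := by decide +kernel

end FinXD

end Summit.HubbardSuperconductivity.HubbardSuperconductivity.Theorems.AnisotropyChord.Transfer.Fibre3
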